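import Literature.NumberTheory.Sieve.SmoothZetaLogDeriv
import Mathlib.Analysis.Calculus.MeanValue
import Mathlib.Analysis.Complex.RealDeriv
import HarnessLib

/-!
# The saddle-point exponent `φ(α + it, y) - φ(α, y) + it log x = -φ₂ t²/2 + O(t³ log y · φ₂)`

(Module docstring completed once the file is stable.)
-/

noncomputable section

open Complex

namespace Literature.NumberTheory.Sieve

variable {x α t τ : ℝ} {y : ℕ} {z : ℂ}

/-! ### The exponent and its derivatives -/

/-- `e(z) = φ(α + iz, y) - φ(α, y) + i z log x`: for real `z = t`, `exp e(t) = ζ(α + it, y) x^{it}/ζ(α, y)`,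
the normalised integrand of the saddle-point integral. [cite: HildebrandTenenbaum1986, §4 (proof of Lemma 10)] -/
def saddleExponent (x α : ℝ) (y : ℕ) (z : ℂ) : ℂ :=
  smoothLogZeta ((α : ℂ) + z * I) y - smoothLogZeta α y + z * (Real.log x) * I

/-- `e'(z) = i (log x - (-φ₁)(α + iz, y))`. [folklore] -/
def saddleExponentDeriv (x α : ℝ) (y : ℕ) (z : ℂ) : ℂ :=
  ((Real.log x : ℂ) - smoothPhi₁ ((α : ℂ) + z * I) y) * I

/-- The inner affine map `z ↦ α + iz` has derivative `i`. [folklore] -/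
theorem hasDerivAt_add_mul_I (α : ℝ) (z : ℂ) : HasDerivAt (fun w : ℂ => (α : ℂ) + w * I) I z := by
  simpa using ((hasDerivAt_id z).mul_const I).const_add (α : ℂ)

/-- `Re(α + iz) = α - Im z`. [folklore] -/
theorem add_mul_I_re (α : ℝ) (z : ℂ) : ((α : ℂ) + z * I).re = α - z.im := by simp; ring

/-- **`e' `**: `HasDerivAt e (i(log x - (-φ₁)(α + iz))) z` whenever `Re(α + iz) > 0`. [folklore] -/
theorem hasDerivAt_saddleExponent (hz : 0 < ((α : ℂ) + z * I).re) :
    HasDerivAt (saddleExponent x α y) (saddleExponentDeriv x α y z) z := by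
  have h1 : HasDerivAt (fun w : ℂ => smoothLogZeta ((α : ℂ) + w * I) y)
      (-smoothPhi₁ ((α : ℂ) + z * I) y * I) z :=
    HasDerivAt.comp (h₂ := fun s : ℂ => smoothLogZeta s y) z (hasDerivAt_smoothLogZeta hz y)
      (hasDerivAt_add_mul_I α z)
  have h2 : HasDerivAt (fun w : ℂ => w * (Real.log x) * I) ((Real.log x : ℂ) * I) z := by
    simpa using ((hasDerivAt_id z).mul_const ((Real.log x : ℂ) * I)).congr_of_eventuallyEq
      (Filter.Eventually.of_forall fun w => by simp [mul_assoc])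
  have h := (h1.sub_const (smoothLogZeta α y)).add h2
  refine h.congr_deriv ?_
  simp [saddleExponentDeriv]
  ring

/-- **`e''`**: `HasDerivAt e' (-φ₂(α + iz)) z` whenever `Re(α + iz) > 0`. [folklore] -/
theorem hasDerivAt_saddleExponentDeriv (hz : 0 < ((α : ℂ) + z * I).re) :
    HasDerivAt (saddleExponentDeriv x α y) (-smoothPhi₂ ((α : ℂ) + z * I) y) z := by
  have h1 : HasDerivAt (fun w : ℂ => smoothPhi₁ ((α : ℂ) + w * I) y)
      (-smoothPhi₂ ((α : ℂ) + z * I) y * I) z :=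
    HasDerivAt.comp (h₂ := fun s : ℂ => smoothPhi₁ s y) z (hasDerivAt_smoothPhi₁ hz y)
      (hasDerivAt_add_mul_I α z)
  have h2 := ((hasDerivAt_const z (Real.log x : ℂ)).sub h1).mul_const I
  refine h2.congr_deriv ?_
  have hI : I * I = -1 := Complex.I_mul_I
  linear_combination (smoothPhi₂ ((α : ℂ) + z * I) y) * hI

/-- `e(0) = 0`. [folklore] -/
theorem saddleExponent_zero (x α : ℝ) (y : ℕ) : saddleExponent x α y 0 = 0 := by
  simp [saddleExponent]

/-- **The saddle-point condition**: at `α = α(x, y)`, `e'(0) = 0` (`-φ₁(α, y) = log x`).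
[cite: HildebrandTenenbaum1986, §2 (2.2)] -/
theorem saddleExponentDeriv_zero (hx : 1 < x) (hy : 2 ≤ y) :
    saddleExponentDeriv x (saddlePoint x y) y 0 = 0 := by
  simp [saddleExponentDeriv, smoothPhi₁_ofReal, saddleSum_saddlePoint hx hy]

/-- `exp e(t) = ζ(α + it, y) x^{it} ζ(α, y)⁻¹` for real `t` (`α > 0`). [folklore] -/
theorem exp_saddleExponent (hα : 0 < α) (x : ℝ) (y : ℕ) (t : ℝ) :
    Complex.exp (saddleExponent x α y t) =
      smoothZetaC ((α : ℂ) + t * I) y * Complex.exp ((t * Real.log x : ℝ) * I) *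
        ((smoothZeta α y : ℝ) : ℂ)⁻¹ := by
  have hre : 0 < ((α : ℂ) + (t : ℂ) * I).re := by simp [hα]
  have hreα : 0 < ((α : ℂ)).re := by simp [hα]
  rw [saddleExponent, sub_add_eq_add_sub, Complex.exp_sub, Complex.exp_add, exp_smoothLogZeta hre,
    smoothLogZeta_ofReal hα, ← Complex.ofReal_exp, Real.exp_log (smoothZeta_pos hα)]
  congr 2
  push_cast
  ring_nf

/-- `‖exp e(t)‖ = ‖ζ(α + it, y)‖/ζ(α, y)` for real `t`. [folklore] -/
theorem norm_exp_saddleExponent (hα : 0 < α) (x : ℝ) (y : ℕ) (t : ℝ) :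
    ‖Complex.exp (saddleExponent x α y t)‖ = ‖smoothZetaC ((α : ℂ) + t * I) y‖ / smoothZeta α y := by
  rw [exp_saddleExponent hα x y t, norm_mul, norm_mul, Complex.norm_exp_ofReal_mul_I, mul_one, norm_inv,
    Complex.norm_real, Real.norm_eq_abs, abs_of_pos (smoothZeta_pos hα), div_eq_mul_inv]

/-! ### The quadratic approximation -/

/-- **`e(t) = -φ₂(α, y) t²/2 + O(τ³ log y · φ₂(α, y))` for `|t| ≤ τ`**: with `α = α(x, y) ≥ 3/5` and
`H(t) = e(t) + φ₂ t²/2`, one has `H(0) = H'(0) = 0` and `‖H''(t)‖ = ‖φ₂(α + it) - φ₂(α)‖ ≤ 13 |t| log y ·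
φ₂` (`norm_smoothPhi₂_sub_le`), whence `‖H(t)‖ ≤ 13 τ³ log y · φ₂(α, y)` by two applications of the mean
value inequality. [cite: HildebrandTenenbaum1986, §4 (4.5)–(4.6)] -/
theorem norm_saddleExponent_add_le (hx : 1 < x) (hy : 2 ≤ y) (hα : 3 / 5 ≤ saddlePoint x y)
    (hτ : 0 < τ) (ht : |t| ≤ τ) :
    ‖saddleExponent x (saddlePoint x y) y t +
        ((saddlePhi₂ (saddlePoint x y) y / 2 * t ^ 2 : ℝ) : ℂ)‖ ≤
      13 * τ ^ 3 * Real.log y * saddlePhi₂ (saddlePoint x y) y := by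
  set α : ℝ := saddlePoint x y with hαdef
  have hα0 : 0 < α := by linarith
  set φ : ℝ := saddlePhi₂ α y with hφ
  have hφ0 : 0 ≤ φ := saddlePhi₂_nonneg α y
  have hlogy : 0 ≤ Real.log y := Real.log_nonneg (by exact_mod_cast le_trans one_le_two hy)
  -- real-parameter versions of `e`, `e'` and the corrected functions `H`, `H'`
  set e : ℝ → ℂ := fun u => saddleExponent x α y u with he
  set e' : ℝ → ℂ := fun u => saddleExponentDeriv x α y u with he'
  set H : ℝ → ℂ := fun u => e u + ((φ / 2 * u ^ 2 : ℝ) : ℂ) with hH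
  set H' : ℝ → ℂ := fun u => e' u + ((φ * u : ℝ) : ℂ) with hH'
  set H'' : ℝ → ℂ := fun u => -smoothPhi₂ ((α : ℂ) + u * I) y + (φ : ℂ) with hH''
  have hre : ∀ u : ℝ, 0 < ((α : ℂ) + (u : ℂ) * I).re := fun u => by simp [hα0]
  -- derivatives along the real axis
  have hHd : ∀ u : ℝ, HasDerivAt H (H' u) u := by
    intro u
    have h1 : HasDerivAt e (e' u) u := (hasDerivAt_saddleExponent (hre u)).comp_ofReal
    have h2 : HasDerivAt (fun u : ℝ => ((φ / 2 * u ^ 2 : ℝ) : ℂ)) ((φ * u : ℝ) : ℂ) u := by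
      have h := ((hasDerivAt_pow 2 u).const_mul (φ / 2)).ofReal_comp
      refine h.congr_deriv ?_
      push_cast; ring
    exact h1.add h2
  have hH'd : ∀ u : ℝ, HasDerivAt H' (H'' u) u := by
    intro u
    have h1 : HasDerivAt e' (-smoothPhi₂ ((α : ℂ) + u * I) y) u :=
      (hasDerivAt_saddleExponentDeriv (hre u)).comp_ofReal
    have h2 : HasDerivAt (fun u : ℝ => ((φ * u : ℝ) : ℂ)) (φ : ℂ) u := by
      have h := ((hasDerivAt_id u).const_mul φ).ofReal_comp
      refine h.congr_deriv ?_
      push_cast; simp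
    exact h1.add h2
  -- values at `0`
  have hH0 : H 0 = 0 := by simp [hH, he, saddleExponent_zero]
  have hH'0 : H' 0 = 0 := by
    simp [hH', he', hαdef, saddleExponentDeriv_zero hx hy]
  -- the bound on `H''` on `[-τ, τ]`
  have hH''b : ∀ u ∈ Set.Icc (-τ) τ, ‖H'' u‖ ≤ 13 * τ * Real.log y * φ := by
    intro u hu
    have hu' : |u| ≤ τ := abs_le.2 ⟨hu.1, hu.2⟩
    calc ‖H'' u‖ = ‖smoothPhi₂ ((α : ℂ) + u * I) y - smoothPhi₂ α y‖ := by
          rw [hH'', smoothPhi₂_ofReal, ← hφ, ← norm_neg]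
          congr 1; ring
      _ ≤ 13 * |u| * Real.log y * φ := norm_smoothPhi₂_sub_le hα u y
      _ ≤ 13 * τ * Real.log y * φ := by gcongr
  -- first mean value inequality: `‖H' u‖ ≤ 13 τ² log y φ` on `[-τ, τ]`
  have hconv : Convex ℝ (Set.Icc (-τ) τ) := convex_Icc _ _
  have h0mem : (0 : ℝ) ∈ Set.Icc (-τ) τ := ⟨by linarith, hτ.le⟩
  have hH'b : ∀ u ∈ Set.Icc (-τ) τ, ‖H' u‖ ≤ 13 * τ ^ 2 * Real.log y * φ := by
    intro u hu
    have h := hconv.norm_image_sub_le_of_norm_hasDerivWithin_le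
      (fun v _ => (hH'd v).hasDerivWithinAt) hH''b h0mem hu
    rw [hH'0, sub_zero] at h
    have hu' : ‖u - 0‖ ≤ τ := by rw [sub_zero, Real.norm_eq_abs]; exact abs_le.2 ⟨hu.1, hu.2⟩
    calc ‖H' u‖ ≤ 13 * τ * Real.log y * φ * ‖u - 0‖ := h
      _ ≤ 13 * τ * Real.log y * φ * τ := mul_le_mul_of_nonneg_left hu' (by positivity)
      _ = 13 * τ ^ 2 * Real.log y * φ := by ring
  -- second mean value inequality
  have ht_mem : t ∈ Set.Icc (-τ) τ := ⟨(abs_le.1 ht).1, (abs_le.1 ht).2⟩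
  have h := hconv.norm_image_sub_le_of_norm_hasDerivWithin_le
    (fun v _ => (hHd v).hasDerivWithinAt) hH'b h0mem ht_mem
  rw [hH0, sub_zero] at h
  have ht' : ‖t - 0‖ ≤ τ := by rw [sub_zero, Real.norm_eq_abs]; exact ht
  calc ‖saddleExponent x α y t + ((φ / 2 * t ^ 2 : ℝ) : ℂ)‖ = ‖H t‖ := rfl
    _ ≤ 13 * τ ^ 2 * Real.log y * φ * ‖t - 0‖ := h
    _ ≤ 13 * τ ^ 2 * Real.log y * φ * τ := mul_le_mul_of_nonneg_left ht' (by positivity)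
    _ = 13 * τ ^ 3 * Real.log y * φ := by ring

end Literature.NumberTheory.Sieve

end
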